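import Summits.Ventures.WeilGRH.UniformConductorFloorCoprimeDataLog8
import HarnessLib

/-!
# GRH arm (rh-explicit, venture WeilGRH): the kernel check of the level-`6` joint cell certificate `certEvenDvd6Log8` (t = (log 8)/2)

Cell `rh-explicit`, WEIL TRACK — GRH ARM (weil-grh-1, gen7 «divisibility floors»).  `JointCert.checkFrame` and `checkCells` of the
even certificate `certEvenDvd6Log8` (`UniformConductorFloorCoprimeDataLog8.lean`), by `decide +kernel` (integer arithmetic only; one parity per
file; `333` cells).  Consumed by `UniformConductorFloorCoprimeFloorsLog8.lean`.  No definitions; no named facts; standard axioms. [folklore]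
-/

namespace Summit.Ventures.WeilGRH

namespace UniformFloor

set_option maxHeartbeats 0 in
set_option maxRecDepth 100000 in
/-- The frame of `certEvenDvd6Log8` checks (shape, `φ` bounds, shifts, exact slab masses, exact constant, `e^{2t} ≤ 9`). [folklore] -/
theorem certEvenDvd6Log8_checkFrame : certEvenDvd6Log8.checkFrame = true := by
  decide +kernel

set_option maxHeartbeats 0 in
set_option maxRecDepth 100000 in
/-- All `333` cell inequalities of `certEvenDvd6Log8` (the zipper `JointCert.checkCells`). [folklore] -/
theorem certEvenDvd6Log8_checkCells : certEvenDvd6Log8.checkCells = true := by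
  decide +kernel

end UniformFloor

end Summit.Ventures.WeilGRH
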